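import Mathlib
import HarnessLib
import Literature.MathematicalPhysics.QuantumLattice.KohnLuttingerLindhardL2Bound
import Summits.HubbardSuperconductivity.HubbardSuperconductivity.Theorems.WeakCouplingBCSWcbcsKohnLuttingerB1gReduction

/-!
# Route `WeakCouplingBCS` — certificate half of stmt-HubbardSuperconductivity-0158, item «(E2)-TPRIME-LINDHARD-BOUND» (pen (R460)(A)), brick (a):
# the `L²` (Hilbert–Schmidt) bound for the Lindhard kernel along ANY continuous chart of the Fermi curve of ANY continuous band — the
# (ε, γ)-GENERIC re-key of `Literature…KohnLuttingerLindhardL2Bound` §K1 (which is written for `squareDispersion 1 0` / `fermiPolar μ` only)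

Cell `gate-hubbard-kl`, seat p4 (g23); zero kit; scope memo `HOME/prover-p4/E2-TPRIME-LINDHARD-SCOPE.md` §4.  For a continuous band `ε : Momentum → ℝ`, a
level `μ` with Lebesgue-null level set, and a continuous chart `γ : ℝ → Momentum` (angles on `(-π, π]`), the chart kernel `K(θ, θ′) = χ₀[ε](γθ + γθ′; μ)`
(`χ₀ = lindhardFunction ε μ = (2π)⁻² ∫_{BZ} F(q, p) dp`) lies in `L²(dθ dθ′ ⌞ (-π,π]²)` GIVEN the two geometric inputs of the `t′ = 0` file, now as hypotheses
about `(ε, γ, μ)`: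
* (TSL) a torus sublevel estimate `λ²{(θ,θ′) : |ε(p + γθ + γθ′) − μ| < s} ≤ C·s^β` (`0 < β < 2`), uniformly in `p`;
* (SV) a shell-volume estimate `vol(BZ ∩ {|ε − μ| < t}) ≤ C_sh·t`.
Route = Stein's Minkowski integral inequality + the abstract layer cake `lintegral_inv_add_sq_le` of the `t′ = 0` file, proofs ported token for token:
* `klg_eLpNorm_lindhardIntegrand_chart_le` — `‖F(γθ+γθ′, p)‖_{L²(dθdθ′)} ≤ √(2C/(2−β))·|ε_p − μ|^{β/2−1}` off the level set;
* `klg_lintegral_rpow_neg_energy_le/_lt_top` — `∫_{BZ} |ε_p − μ|^{−r} dp ≤ vol(BZ) + C_sh/(r⁻¹ − 1)` (`0 < r < 1`) from (SV);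
* `klg_memLp_lindhardKernel_chart` — **(K1′) `K ∈ L²(dθ dθ′)`** from (TSL), (SV) and the null level set;
* `klg_memLp_kernel_of_chart_dominated` — transport to the Fermi-curve measure: if `σ = fermiCurveMeasure ε μ ≤ w₁ • γ_* (dθ ⌞ (-π,π])` then the kernel
  `(k, k′) ↦ χ₀(k + k′)` is in `L²(σ ⊗ σ)` — the Hilbert–Schmidt row consumed by `kltp_pocket_analytic_of_HS` (…KlCertTPrimePocketAnalyticHS);
* `klg_memLp_kernel_of_geometry` — the composition: chart domination + (TSL) + (SV) + null level set ⟹ the HS row (the three NAMED analytic statements a `t′`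
  record's `χ₀` hypothesis reduces to).
At `(squareDispersion 1 0, fermiPolar μ)` these are the Literature theorems verbatim; for the `t′` hole pocket the chart, (TSL) and (SV) are the memo's (N1)–(N3).
Everything is proved; no definitions; nothing here asserts (TSL)/(SV)/a chart for any `t′`, a margin, `K₃`, `U₀`, the window or superconductivity.
References: E. M. Stein, *Singular Integrals and Differentiability Properties of Functions* (1970), App. A.1 [cite: SteinSingularIntegrals1970, App. A.1];
S. Raghu, S. A. Kivelson, D. J. Scalapino, Phys. Rev. B 81 (2010) 224505, §II (5)–(7).
-/

noncomputable section

-- the tree's namespace `Summit.<Summit>.<Problem>.Theorems` repeats the summit name by design (D-0017)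
set_option linter.dupNamespace false

namespace Summit.HubbardSuperconductivity.HubbardSuperconductivity.Theorems

open Real Set Filter MeasureTheory MeasureTheory.Measure Literature.MathematicalPhysics.QuantumLattice
open scoped Topology ENNReal NNReal

/-! ### The `L²(dθ dθ′)` bound of a `p`-section of the Lindhard integrand from the torus sublevel estimate -/

/-- The sum map `(θ, θ′) ↦ γθ + γθ′` of a continuous chart is continuous. [folklore] -/
theorem klg_continuous_chart_sum {γ : ℝ → Momentum} (hγ : Continuous γ) : Continuous fun z : ℝ × ℝ => γ z.1 + γ z.2 :=
  (hγ.comp continuous_fst).add (hγ.comp continuous_snd)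

section Chart

variable {ε : Momentum → ℝ} (hε : Continuous ε) {γ : ℝ → Momentum} (hγ : Continuous γ) (μ : ℝ)
include hε hγ

/-- The Lindhard integrand along the sum map is jointly measurable in `((θ,θ′), p)`. [folklore] -/
theorem klg_measurable_lindhardIntegrand_chart :
    Measurable fun x : (ℝ × ℝ) × Momentum => lindhardIntegrand ε μ (γ x.1.1 + γ x.1.2) x.2 := by
  have hS : Measurable fun x : (ℝ × ℝ) × Momentum => (γ x.1.1 + γ x.1.2, x.2) :=
    ((klg_continuous_chart_sum hγ).measurable.comp measurable_fst).prodMk measurable_snd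
  exact (measurable_lindhardIntegrand_uncurry hε.measurable μ).comp hS

/-- **`‖F(γθ + γθ′, p)‖_{L²(dθdθ′)} ≤ √(2C/(2−β)) · |ε_p − μ|^{β/2−1}`** for `p` off the level set, given the torus sublevel estimate at `(μ, p)`.
[cite: SteinSingularIntegrals1970, App. A.1] -/
theorem klg_eLpNorm_lindhardIntegrand_chart_le (p : Momentum) {C β : ℝ} (hC : 0 ≤ C) (hβ2 : β < 2)
    (hTSL : ∀ s : ℝ, 0 < s →
      ((volume.restrict (Ioc (-π) π)).prod (volume.restrict (Ioc (-π) π)))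
        {z : ℝ × ℝ | |ε (p + (γ z.1 + γ z.2)) - μ| < s} ≤ ENNReal.ofReal (C * s ^ β))
    (hp : ε p ≠ μ) :
    eLpNorm (fun z : ℝ × ℝ => lindhardIntegrand ε μ (γ z.1 + γ z.2) p) 2
        ((volume.restrict (Ioc (-π) π)).prod (volume.restrict (Ioc (-π) π))) ≤
      ENNReal.ofReal (Real.sqrt (2 * C / (2 - β)) * |ε p - μ| ^ (β / 2 - 1)) := by
  set ν : Measure (ℝ × ℝ) := (volume.restrict (Ioc (-π) π)).prod (volume.restrict (Ioc (-π) π)) with hν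
  set a : ℝ := |ε p - μ| with ha
  have ha0 : 0 < a := abs_pos.2 (sub_ne_zero.2 hp)
  set X : ℝ × ℝ → ℝ := fun z => |ε (p + (γ z.1 + γ z.2)) - μ| with hX
  have hXm : Measurable X := by
    have hc : Continuous fun z : ℝ × ℝ => ε (p + (γ z.1 + γ z.2)) :=
      hε.comp (continuous_const.add (klg_continuous_chart_sum hγ))
    exact (hc.sub continuous_const).abs.measurable
  set F : ℝ × ℝ → ℝ := fun z => lindhardIntegrand ε μ (γ z.1 + γ z.2) p with hF
  have hF0 : ∀ z, 0 ≤ F z := fun z => lindhardIntegrand_nonneg _ _ _ _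
  have hFle : ∀ z, F z ≤ (a + X z)⁻¹ := fun z => (lindhardIntegrand_le_inv _ _ _ _).trans_eq (one_div _)
  rw [eLpNorm_eq_lintegral_rpow_enorm_toReal two_ne_zero ENNReal.ofNat_ne_top, ENNReal.toReal_ofNat]
  have hmono : ∫⁻ z, ‖F z‖ₑ ^ (2 : ℝ) ∂ν ≤ ∫⁻ z, ENNReal.ofReal (((a + X z)⁻¹) ^ 2) ∂ν := by
    refine lintegral_mono fun z => ?_
    rw [Real.enorm_eq_ofReal (hF0 z), ENNReal.ofReal_rpow_of_nonneg (hF0 z) (by norm_num), Real.rpow_two]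
    exact ENNReal.ofReal_le_ofReal (pow_le_pow_left₀ (hF0 z) (hFle z) 2)
  have hlc := lintegral_inv_add_sq_le ν (fun z => abs_nonneg _) hXm hC hβ2 hTSL ha0
  have hK0 : 0 ≤ 2 * C / (2 - β) := div_nonneg (by positivity) (by linarith)
  calc (∫⁻ z, ‖F z‖ₑ ^ (2 : ℝ) ∂ν) ^ (1 / (2 : ℝ))
      ≤ (ENNReal.ofReal (2 * C / (2 - β) * a ^ (β - 2))) ^ (1 / (2 : ℝ)) :=
        ENNReal.rpow_le_rpow (hmono.trans hlc) (by norm_num)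
    _ = ENNReal.ofReal (Real.sqrt (2 * C / (2 - β)) * a ^ (β / 2 - 1)) := by
        rw [ENNReal.ofReal_rpow_of_nonneg (by positivity) (by norm_num)]
        congr 1
        rw [Real.mul_rpow hK0 (Real.rpow_nonneg ha0.le _), ← Real.sqrt_eq_rpow, ← Real.rpow_mul ha0.le]
        congr 2; ring

end Chart

/-! ### Integrability of `|ε_p − μ|^{−r}` over the Brillouin zone from the shell-volume estimate -/

/-- **`∫_{BZ} |ε_p − μ|^{−r} dp ≤ vol(BZ) + C_sh/(r⁻¹ − 1)`** for `0 < r < 1`, given the shell-volume estimate `vol(BZ ∩ {|ε − μ| < t}) ≤ C_sh t`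
(layer cake; ANY continuous band). [cite: SteinSingularIntegrals1970, App. A.1] -/
theorem klg_lintegral_rpow_neg_energy_le {ε : Momentum → ℝ} (hε : Continuous ε) {μ r Csh : ℝ} (hr0 : 0 < r) (hr1 : r < 1) (hCsh : 0 ≤ Csh)
    (hSV : ∀ t : ℝ, 0 < t → volume (brillouinZone ∩ {p : Momentum | |ε p - μ| < t}) ≤ ENNReal.ofReal (Csh * t)) :
    ∫⁻ p in brillouinZone, ENNReal.ofReal (|ε p - μ| ^ (-r)) ≤ volume brillouinZone + ENNReal.ofReal (Csh * (r⁻¹ - 1)⁻¹) := by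
  set P : Measure Momentum := volume.restrict brillouinZone with hP
  set f : Momentum → ℝ := fun p => |ε p - μ| ^ (-r) with hf
  have hf0 : ∀ p, 0 ≤ f p := fun p => Real.rpow_nonneg (abs_nonneg _) _
  have ham : Measurable fun p : Momentum => |ε p - μ| := (hε.sub continuous_const).abs.measurable
  have hfm : Measurable f := ham.pow_const _
  rw [lintegral_eq_lintegral_meas_lt P (Eventually.of_forall hf0) hfm.aemeasurable]
  have hbound : ∀ t ∈ Ioi (0 : ℝ), P {p | t < f p} ≤
      (Ioc (0 : ℝ) 1).indicator (fun _ => volume brillouinZone) t +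
        (Ioi (1 : ℝ)).indicator (fun t => ENNReal.ofReal (Csh * t ^ (-r⁻¹))) t := by
    intro t ht
    have ht0 : (0 : ℝ) < t := ht
    by_cases ht1 : t ≤ 1
    · rw [indicator_of_mem (show t ∈ Ioc (0 : ℝ) 1 from ⟨ht0, ht1⟩),
        indicator_of_notMem (fun h : t ∈ Ioi (1 : ℝ) => not_lt.2 ht1 h)]
      rw [add_zero]
      calc P {p | t < f p} ≤ P univ := measure_mono (subset_univ _)
        _ = volume brillouinZone := by rw [hP, Measure.restrict_apply_univ]
    · rw [indicator_of_notMem (fun h : t ∈ Ioc (0 : ℝ) 1 => ht1 h.2),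
        indicator_of_mem (show t ∈ Ioi (1 : ℝ) from not_le.1 ht1), zero_add]
      have hsubset : {p | t < f p} ⊆ {p : Momentum | |ε p - μ| < t ^ (-r⁻¹)} := by
        intro p (hpt : t < f p)
        show |ε p - μ| < t ^ (-r⁻¹)
        by_contra hge
        have hge : t ^ (-r⁻¹) ≤ |ε p - μ| := not_lt.1 hge
        have htpow : 0 < t ^ (-r⁻¹) := Real.rpow_pos_of_pos ht0 _
        have : f p ≤ t := by
          rw [hf]
          calc |ε p - μ| ^ (-r) ≤ (t ^ (-r⁻¹)) ^ (-r) := Real.rpow_le_rpow_of_nonpos htpow hge (by linarith)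
            _ = t := by rw [← Real.rpow_mul ht0.le]; field_simp; exact Real.rpow_one t
        linarith
      calc P {p | t < f p} ≤ P {p : Momentum | |ε p - μ| < t ^ (-r⁻¹)} := measure_mono hsubset
        _ = volume (brillouinZone ∩ {p : Momentum | |ε p - μ| < t ^ (-r⁻¹)}) := by
            rw [hP, Measure.restrict_apply (measurableSet_lt ham measurable_const), inter_comm]
        _ ≤ ENNReal.ofReal (Csh * t ^ (-r⁻¹)) := hSV _ (Real.rpow_pos_of_pos ht0 _)
  have hexp : -r⁻¹ < -1 := by
    rw [neg_lt_neg_iff]; exact one_lt_inv₀ hr0 |>.2 hr1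
  calc ∫⁻ t in Ioi 0, P {p | t < f p}
      ≤ ∫⁻ t in Ioi 0, ((Ioc (0 : ℝ) 1).indicator (fun _ => volume brillouinZone) t +
          (Ioi (1 : ℝ)).indicator (fun t => ENNReal.ofReal (Csh * t ^ (-r⁻¹))) t) :=
        setLIntegral_mono' measurableSet_Ioi hbound
    _ ≤ volume brillouinZone + ENNReal.ofReal (Csh * (r⁻¹ - 1)⁻¹) := by
        rw [lintegral_add_left (Measurable.indicator measurable_const measurableSet_Ioc)]
        refine add_le_add ?_ ?_
        · rw [lintegral_indicator measurableSet_Ioc, setLIntegral_const]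
          calc volume brillouinZone * (volume.restrict (Ioi (0 : ℝ))) (Ioc 0 1)
              ≤ volume brillouinZone * 1 := by
                refine mul_le_mul_right ((Measure.restrict_apply_le _ _).trans ?_) _
                rw [Real.volume_Ioc]; simp
            _ = volume brillouinZone := mul_one _
        · rw [lintegral_indicator measurableSet_Ioi, Measure.restrict_restrict measurableSet_Ioi,
            inter_eq_left.2 (Ioi_subset_Ioi zero_le_one)]
          have hint : IntegrableOn (fun t : ℝ => Csh * t ^ (-r⁻¹)) (Ioi 1) :=
            (integrableOn_Ioi_rpow_of_lt hexp zero_lt_one).const_mul Csh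
          rw [← ofReal_integral_eq_lintegral_ofReal hint]
          · refine ENNReal.ofReal_le_ofReal (le_of_eq ?_)
            rw [integral_const_mul, integral_Ioi_rpow_of_lt hexp zero_lt_one, Real.one_rpow]
            have hne : -r⁻¹ + 1 ≠ 0 := by linarith
            have hne' : r⁻¹ - 1 ≠ 0 := by linarith
            rw [show -r⁻¹ + 1 = -(r⁻¹ - 1) by ring, div_neg, neg_div, neg_neg, one_div]
          · exact (ae_restrict_iff' measurableSet_Ioi).2 (Eventually.of_forall fun t ht => by
              have : 0 ≤ t ^ (-r⁻¹) := Real.rpow_nonneg (zero_le_one.trans (le_of_lt ht)) _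
              positivity)

/-- **`∫_{BZ} |ε_p − μ|^{−r} dp < ∞`** for `0 < r < 1`, given the shell-volume estimate. [cite: SteinSingularIntegrals1970, App. A.1] -/
theorem klg_lintegral_rpow_neg_energy_lt_top {ε : Momentum → ℝ} (hε : Continuous ε) {μ r Csh : ℝ} (hr0 : 0 < r) (hr1 : r < 1) (hCsh : 0 ≤ Csh)
    (hSV : ∀ t : ℝ, 0 < t → volume (brillouinZone ∩ {p : Momentum | |ε p - μ| < t}) ≤ ENNReal.ofReal (Csh * t)) :
    ∫⁻ p in brillouinZone, ENNReal.ofReal (|ε p - μ| ^ (-r)) < ⊤ :=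
  (klg_lintegral_rpow_neg_energy_le hε hr0 hr1 hCsh hSV).trans_lt
    (ENNReal.add_lt_top.2 ⟨volume_brillouinZone_lt_top, ENNReal.ofReal_lt_top⟩)

/-! ### (K1′): the chart Lindhard kernel is in `L²(dθ dθ′)` -/

section K1

variable {ε : Momentum → ℝ} (hε : Continuous ε) {γ : ℝ → Momentum} (hγ : Continuous γ) (μ : ℝ)
include hε hγ

/-- The `dp`-integral of the chart Lindhard integrand is a.e.-strongly measurable in `(θ, θ′)`. [folklore] -/
theorem klg_aestronglyMeasurable_integral_lindhardIntegrand_chart :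
    AEStronglyMeasurable (fun z : ℝ × ℝ => ∫ p in brillouinZone, lindhardIntegrand ε μ (γ z.1 + γ z.2) p)
      ((volume.restrict (Ioc (-π) π)).prod (volume.restrict (Ioc (-π) π))) := by
  have hsm : StronglyMeasurable (Function.uncurry fun (z : ℝ × ℝ) (p : Momentum) => lindhardIntegrand ε μ (γ z.1 + γ z.2) p) :=
    (klg_measurable_lindhardIntegrand_chart hε hγ μ).stronglyMeasurable
  exact (StronglyMeasurable.integral_prod_right (ν := volume.restrict brillouinZone) hsm).aestronglyMeasurable

/-- **`∫_{BZ} ‖F(γθ+γθ′, p)‖_{L²(dθdθ′)} dp < ∞`** given (TSL) uniformly in `p`, (SV) at level `μ`, and a Lebesgue-null level set `{ε = μ}`.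
[cite: SteinSingularIntegrals1970, App. A.1] -/
theorem klg_lintegral_eLpNorm_lindhardIntegrand_chart_lt_top {C β Csh : ℝ} (hC : 0 ≤ C) (hβ0 : 0 < β) (hβ2 : β < 2) (hCsh : 0 ≤ Csh)
    (hTSL : ∀ (p : Momentum) (s : ℝ), 0 < s →
      ((volume.restrict (Ioc (-π) π)).prod (volume.restrict (Ioc (-π) π)))
        {z : ℝ × ℝ | |ε (p + (γ z.1 + γ z.2)) - μ| < s} ≤ ENNReal.ofReal (C * s ^ β))
    (hSV : ∀ t : ℝ, 0 < t → volume (brillouinZone ∩ {p : Momentum | |ε p - μ| < t}) ≤ ENNReal.ofReal (Csh * t))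
    (hlevel : volume {p : Momentum | ε p = μ} = 0) :
    ∫⁻ p in brillouinZone, eLpNorm (fun z : ℝ × ℝ => lindhardIntegrand ε μ (γ z.1 + γ z.2) p) 2
      ((volume.restrict (Ioc (-π) π)).prod (volume.restrict (Ioc (-π) π))) < ⊤ := by
  set ν : Measure (ℝ × ℝ) := (volume.restrict (Ioc (-π) π)).prod (volume.restrict (Ioc (-π) π)) with hν
  set P : Measure Momentum := volume.restrict brillouinZone with hP
  set K : ℝ := Real.sqrt (2 * C / (2 - β)) with hK
  have hae : ∀ᵐ p ∂P, eLpNorm (fun z : ℝ × ℝ => lindhardIntegrand ε μ (γ z.1 + γ z.2) p) 2 ν ≤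
      ENNReal.ofReal (K * |ε p - μ| ^ (β / 2 - 1)) := by
    have hnull : ∀ᵐ p ∂P, ε p ≠ μ := by
      rw [hP]
      refine ae_restrict_of_ae ?_
      rw [ae_iff]
      simp only [not_not]
      exact hlevel
    filter_upwards [hnull] with p hp
    exact klg_eLpNorm_lindhardIntegrand_chart_le hε hγ μ p hC hβ2 (hTSL p) hp
  have hfin : ∫⁻ p, ENNReal.ofReal (K * |ε p - μ| ^ (β / 2 - 1)) ∂P < ⊤ := by
    have hK0 : 0 ≤ K := Real.sqrt_nonneg _
    have hrw : ∀ p, ENNReal.ofReal (K * |ε p - μ| ^ (β / 2 - 1)) =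
        ENNReal.ofReal K * ENNReal.ofReal (|ε p - μ| ^ (-(1 - β / 2))) := fun p => by
      rw [← ENNReal.ofReal_mul hK0]
      congr 2
      rw [show -(1 - β / 2) = β / 2 - 1 by ring]
    simp_rw [hrw]
    have ham : Measurable fun p : Momentum => |ε p - μ| := (hε.sub continuous_const).abs.measurable
    have hmeas : Measurable fun p : Momentum => ENNReal.ofReal (|ε p - μ| ^ (-(1 - β / 2))) :=
      ENNReal.measurable_ofReal.comp (ham.pow_const _)
    rw [lintegral_const_mul _ hmeas]
    refine ENNReal.mul_lt_top ENNReal.ofReal_lt_top ?_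
    exact klg_lintegral_rpow_neg_energy_lt_top hε (r := 1 - β / 2) (by linarith) (by linarith) hCsh hSV
  exact (lintegral_mono_ae hae).trans_lt hfin

/-- **(K1′) The chart Lindhard kernel `(θ, θ′) ↦ χ₀[ε](γθ + γθ′; μ)` lies in `L²(dθ dθ′ ⌞ (-π,π]²)`**, given (TSL) uniformly in `p`, (SV) at level `μ`
and a null level set. Minkowski's integral inequality + `klg_lintegral_eLpNorm_lindhardIntegrand_chart_lt_top`. [cite: SteinSingularIntegrals1970, App. A.1] -/
theorem klg_memLp_lindhardKernel_chart {C β Csh : ℝ} (hC : 0 ≤ C) (hβ0 : 0 < β) (hβ2 : β < 2) (hCsh : 0 ≤ Csh)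
    (hTSL : ∀ (p : Momentum) (s : ℝ), 0 < s →
      ((volume.restrict (Ioc (-π) π)).prod (volume.restrict (Ioc (-π) π)))
        {z : ℝ × ℝ | |ε (p + (γ z.1 + γ z.2)) - μ| < s} ≤ ENNReal.ofReal (C * s ^ β))
    (hSV : ∀ t : ℝ, 0 < t → volume (brillouinZone ∩ {p : Momentum | |ε p - μ| < t}) ≤ ENNReal.ofReal (Csh * t))
    (hlevel : volume {p : Momentum | ε p = μ} = 0) :
    MemLp (fun z : ℝ × ℝ => lindhardFunction ε μ (γ z.1 + γ z.2)) 2 ((volume.restrict (Ioc (-π) π)).prod (volume.restrict (Ioc (-π) π))) := by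
  set ν : Measure (ℝ × ℝ) := (volume.restrict (Ioc (-π) π)).prod (volume.restrict (Ioc (-π) π)) with hν
  set P : Measure Momentum := volume.restrict brillouinZone with hP
  set g : ℝ × ℝ → ℝ := fun z => ∫ p in brillouinZone, lindhardIntegrand ε μ (γ z.1 + γ z.2) p with hg
  have hgm : AEStronglyMeasurable g ν := klg_aestronglyMeasurable_integral_lindhardIntegrand_chart hε hγ μ
  have hMink : eLpNorm g 2 ν ≤ ∫⁻ p, eLpNorm (fun z : ℝ × ℝ => lindhardIntegrand ε μ (γ z.1 + γ z.2) p) 2 ν ∂P := by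
    have hF : AEStronglyMeasurable (Function.uncurry fun (z : ℝ × ℝ) (p : Momentum) => lindhardIntegrand ε μ (γ z.1 + γ z.2) p) (ν.prod P) :=
      (klg_measurable_lindhardIntegrand_chart hε hγ μ).aestronglyMeasurable
    exact Literature.Analysis.FunctionSpaces.eLpNorm_integral_le_lintegral_eLpNorm hF (p := 2) (by norm_num) ENNReal.ofNat_ne_top
  have hg2 : MemLp g 2 ν :=
    ⟨hgm, hMink.trans_lt (klg_lintegral_eLpNorm_lindhardIntegrand_chart_lt_top hε hγ μ hC hβ0 hβ2 hCsh hTSL hSV hlevel)⟩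
  have hfun : (fun z : ℝ × ℝ => lindhardFunction ε μ (γ z.1 + γ z.2)) = fun z => ((2 * π) ^ 2)⁻¹ * g z := by
    funext z
    simp only [lindhardFunction, hg]
    rw [div_eq_inv_mul]
  rw [hfun]
  exact hg2.const_mul _

/-! ### Transport to the Fermi-curve measure -/

/-- **The Hilbert–Schmidt row on `σ ⊗ σ` from the chart kernel**: if the Fermi-curve measure is dominated by a finite multiple of the pushed-forward angle
measure, `σ = fermiCurveMeasure ε μ ≤ w₁ • γ_* (dθ ⌞ (-π,π])`, and the chart kernel is in `L²(dθ dθ′)`, then `(k, k′) ↦ χ₀[ε](k + k′; μ)` is in `L²(σ ⊗ σ)`.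
[cite: RaghuKivelsonScalapino2010, §II (7)] -/
theorem klg_memLp_kernel_of_chart_dominated {w₁ : ℝ}
    (hσ : fermiCurveMeasure ε μ ≤ ENNReal.ofReal w₁ • Measure.map γ (volume.restrict (Ioc (-π) π)))
    (hK : MemLp (fun z : ℝ × ℝ => lindhardFunction ε μ (γ z.1 + γ z.2)) 2 ((volume.restrict (Ioc (-π) π)).prod (volume.restrict (Ioc (-π) π)))) :
    MemLp (fun z : Momentum × Momentum => lindhardFunction ε μ (z.1 + z.2)) 2 ((fermiCurveMeasure ε μ).prod (fermiCurveMeasure ε μ)) := by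
  have hFm : Measurable γ := hγ.measurable
  have hfm : Measurable (fun z : Momentum × Momentum => lindhardFunction ε μ (z.1 + z.2)) :=
    (measurable_lindhardFunction hε.measurable μ).comp measurable_add
  have hmap : MemLp (fun z : Momentum × Momentum => lindhardFunction ε μ (z.1 + z.2)) 2
      (Measure.map (Prod.map γ γ) ((volume.restrict (Ioc (-π) π)).prod (volume.restrict (Ioc (-π) π)))) :=
    (memLp_map_measure_iff hfm.aestronglyMeasurable (hFm.prodMap hFm).aemeasurable).2 hK
  refine hmap.of_measure_le_smul (c := ENNReal.ofReal w₁ * ENNReal.ofReal w₁) (ENNReal.mul_ne_top ENNReal.ofReal_ne_top ENNReal.ofReal_ne_top) ?_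
  calc (fermiCurveMeasure ε μ).prod (fermiCurveMeasure ε μ)
      ≤ (ENNReal.ofReal w₁ • Measure.map γ (volume.restrict (Ioc (-π) π))).prod (ENNReal.ofReal w₁ • Measure.map γ (volume.restrict (Ioc (-π) π))) :=
        Measure.prod_mono hσ hσ
    _ = (ENNReal.ofReal w₁ * ENNReal.ofReal w₁) • Measure.map (Prod.map γ γ)
          ((volume.restrict (Ioc (-π) π)).prod (volume.restrict (Ioc (-π) π))) := by
        rw [Measure.prod_smul_left, Measure.prod_smul_right, Measure.map_prod_map _ _ hFm hFm, smul_smul]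

/-- **THE HILBERT–SCHMIDT ROW FROM THREE GEOMETRIC STATEMENTS ABOUT `(ε, μ)` AND A CHART** (the composition the `t′` records need; scope memo §7 (a)): a
continuous chart `γ` dominating the Fermi-curve measure (`σ ≤ w₁ • γ_* dθ`), the torus sublevel estimate (TSL) uniformly in `p`, the shell-volume estimate
(SV) and a null level set give `(k, k′) ↦ χ₀[ε](k + k′; μ) ∈ L²(σ ⊗ σ)`. [cite: SteinSingularIntegrals1970, App. A.1] -/
theorem klg_memLp_kernel_of_geometry {w₁ C β Csh : ℝ}
    (hσ : fermiCurveMeasure ε μ ≤ ENNReal.ofReal w₁ • Measure.map γ (volume.restrict (Ioc (-π) π)))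
    (hC : 0 ≤ C) (hβ0 : 0 < β) (hβ2 : β < 2) (hCsh : 0 ≤ Csh)
    (hTSL : ∀ (p : Momentum) (s : ℝ), 0 < s →
      ((volume.restrict (Ioc (-π) π)).prod (volume.restrict (Ioc (-π) π)))
        {z : ℝ × ℝ | |ε (p + (γ z.1 + γ z.2)) - μ| < s} ≤ ENNReal.ofReal (C * s ^ β))
    (hSV : ∀ t : ℝ, 0 < t → volume (brillouinZone ∩ {p : Momentum | |ε p - μ| < t}) ≤ ENNReal.ofReal (Csh * t))
    (hlevel : volume {p : Momentum | ε p = μ} = 0) :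
    MemLp (fun z : Momentum × Momentum => lindhardFunction ε μ (z.1 + z.2)) 2 ((fermiCurveMeasure ε μ).prod (fermiCurveMeasure ε μ)) :=
  klg_memLp_kernel_of_chart_dominated hε hγ μ hσ (klg_memLp_lindhardKernel_chart hε hγ μ hC hβ0 hβ2 hCsh hTSL hSV hlevel)

end K1

end Summit.HubbardSuperconductivity.HubbardSuperconductivity.Theorems

end
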